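import Summits.AtomisticToContinuum.HydrodynamicLimit.Theorems.CollisionIsometryCLTCollisionalTransferLocalityEnvelopeA
import Summits.AtomisticToContinuum.HydrodynamicLimit.Theorems.CollisionIsometryCLTCollisionalTransferLocalityKineticIntegrandDominators
import Summits.AtomisticToContinuum.HydrodynamicLimit.Theorems.CollisionIsometryCLTCollisionalTransferLocalityBlockStressDominatorConst
import Summits.AtomisticToContinuum.HydrodynamicLimit.Theorems.CollisionIsometryCLTCollisionalTransferLocalityBlockHeatFluxDominatorConst
import Summits.AtomisticToContinuum.HydrodynamicLimit.Theorems.CollisionIsometryCLTCollisionalTransferLocalityMollifiedCeilingConst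
import Summits.AtomisticToContinuum.HydrodynamicLimit.Theorems.CollisionIsometryCLTCollisionalTransferLocalityCompressibilityLinear
import Summits.AtomisticToContinuum.HydrodynamicLimit.Theorems.CollisionIsometryCLTCollisionalTransferLocalityConeValue
import Summits.AtomisticToContinuum.HydrodynamicLimit.Theorems.CollisionIsometryCLTCollisionalTransferLocalityFlowMeasurable
import Summits.AtomisticToContinuum.HydrodynamicLimit.Theorems.CollisionIsometryCLTCollisionalTransferLocalityKfunAConst
import HarnessLib

/-!
# [K0C] The kinetic-correction functional of the CONE kernel vanishes at global equilibrium
(stub `stub_kfunA_cone_const`, line `hemisphere-affine-slaving`, crux `CollisionalTransferLocality`,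
stmt-AtomisticToContinuum-9518)

Supporting file (`--supports stmt-AtomisticToContinuum-9518`) proving the registered stub [K0C] VERBATIM: for
`θ > 0` there is `σ₀ > 0` such that for `0 < σ < σ₀`, every flow family `Φ`, `t > 0`, FIXED cone radius
`0 < r < 1/4`, matrix weight `A` smooth on `[0, t]`, `τ ∈ [0, t]`, `δ > 0`, under the homogeneous local Gibbs law
`G_N = localGibbsLaw σ 1 0 θ N (Φ N)` the kinetic-correction value `KfunA(τ) = ∫₀^τ∫ₓ kinWA · p_c(ρ̄, θ̄)` of the
constant kernel family `b_r(·, 0)` obeys `G_N{δ < |KfunA(τ)|} → 0`.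

Proof. (i) Pointwise (`abs_kin_le`): `kinWA · p_c = (2/5)(D̄ : A)(Z(ρ̄σ³) − 1)` off the guard, `|Z(η) − 1| ≤ Kη` on
`[0, η_Z]` ([Z] `stub_hsCompressibility_linear`), `|A_ab| ≤ C_A` on `[0, t] × 𝕋³` (compactness,
`KfunAConst.exists_bound_of_smoothMatrixOn` of the mesoscale twin [K0A]), `|D̄_ab| ≤ κ + D̄_ab²/κ`:
on a block with `ρ̄σ³ ≤ η₁ ≤ η_Z`, `|kinWA · p_c| ≤ Lκ + (L/κ)(Σ D̄² + |q|²)`, `L = (18/5) K η₁ C_A`. (ii) Along the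
orbit, in `ℝ≥0∞` (`‖∫ f‖ₑ ≤ ∫⁻ ‖f‖ₑ`, valid for junk Bochner integrals; `ofReal_abs_KfunA_le`):
`ofReal |KfunA(τ)| ≤ ofReal (Lκt) + ofReal (L/κ) ∫⁻_{[0,t]}∫⁻ₓ ofReal (Σ D̄² + |q|²)(Φ_s z, x)`. (iii) Off the ceiling
event of [MC] `stub_mollifiedCeilingConst` (probability `→ 0`, `r < 1/4`) every block has `ρ̄σ³ = ρ_r σ³ ≤ 2σ³ =: η₁ ≤ η_Z`
(`ConeValue.rhoB_cone`, `σ ≤ min 1/2 (η_Z/2)`). (iv) Statics (`tendsto_lintegral_kinetic`): for continuous kernels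
`0 ≤ φ_N ≤ M` of mass one with `M` FIXED (here `3/(π r³)`), `E_{G_N} ∫⁻ₓ ofReal (Σ D̄² + |q|²) ≤ 4 E∫⁻(A+B) + 50 E∫⁻(T+B₂) → 0`
by [KF-dom] `stub_kineticIntegrand_le_dominators`, `BlockStressDominatorConst.lintegral_dominator_le` (`M K_θ/√(N+1)`)
and `BlockHeatFluxDominatorConst.lintegral_F_le` (`(5/4) E|v|⁶ M/(N+1)`). (v) Union bound with the ceiling event,
Markov off the null bad set through the jointly measurable modification of the flow (`exists_measurable_flow`),
Tonelli and stationarity (`lintegral_comp_flow_localGibbsLaw_const`), as in …FmrConst (`measure_le_of_stationary`):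
with `Lκt ≤ δ/2` the probability is `≤ P(ceiling) + (L/κ) t E G_N/(δ/2) → 0`. Folklore; no definitions, no named facts.
-/

namespace Summit.AtomisticToContinuum.HydrodynamicLimit.Theorems.HemisphereAffineSlaving

open scoped BigOperators Topology Classical ENNReal InnerProductSpace
open Filter Set Function MeasureTheory

noncomputable section

open Literature.MathematicalPhysics.KineticTheory (T3 V3)
open Literature.MathematicalPhysics.KineticTheory (localGibbsLaw isProbabilityMeasure_localGibbsLaw
  hsCompressibility gaussMeasure coneKernel mollDensity coneKernel_mem_Icc integral_coneKernel)

namespace KfunAConeConst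

variable {N : ℕ} {φ : ℕ → T3 → ℝ}

/-- **Pointwise envelope with the block stress kept.** On a block with `ρ̄σ³ ≤ η₁ ≤ η_Z`, for
`|Z(η) − 1| ≤ Kη` on `[0, η_Z]`, `|A_ab| ≤ C_A` and `κ > 0`:
`|kinWA · p_c(ρ̄, θ̄)| ≤ Lκ + (L/κ)(Σ_jk D̄_jk² + |q|²)`, `L = (18/5) K η₁ C_A`
(`kinWA · p_c = (2/5)(D̄ : A)(Z − 1)` off the guard `pkin = 0`, `0` on it; `|D̄_ab| ≤ κ + D̄_ab²/κ`). [folklore] -/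
theorem abs_kin_le {w : Cfg N} {x : T3} {σ K ηZ η₁ CA κ : ℝ} (hσ : 0 < σ) (hK : 0 ≤ K)
    (hη₁Z : η₁ ≤ ηZ) (hZ : ∀ η : ℝ, 0 ≤ η → η ≤ ηZ → |hsCompressibility η - 1| ≤ K * η)
    (hφ0 : ∀ y, 0 ≤ φ N y) {A : ℝ → T3 → Fin 3 → Fin 3 → ℝ} {s : ℝ}
    (hA : ∀ a b, |A s x a b| ≤ CA) (hhi : rhoB φ N w x * σ ^ 3 ≤ η₁) (hκ : 0 < κ) :
    |kinWA A φ N s w x * pcoll σ (rhoB φ N w x) (thetaB φ N w x)| ≤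
      18 / 5 * K * η₁ * CA * κ + 18 / 5 * K * η₁ * CA / κ *
        ((∑ j, ∑ k, Dst φ N w x j k ^ 2) + ‖qfl φ N w x‖ ^ 2) := by
  have hη0 : 0 ≤ rhoB φ N w x * σ ^ 3 := mul_nonneg (rhoB_nonneg hφ0) (pow_nonneg hσ.le 3)
  have hZm : |hsCompressibility (rhoB φ N w x * σ ^ 3) - 1| ≤ K * η₁ :=
    (hZ _ hη0 (hhi.trans hη₁Z)).trans (mul_le_mul_of_nonneg_left hhi hK)
  have hCA : 0 ≤ CA := (abs_nonneg _).trans (hA 0 0)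
  set F : ℝ := (∑ j, ∑ k, Dst φ N w x j k ^ 2) + ‖qfl φ N w x‖ ^ 2 with hF
  have hF0 : 0 ≤ F := by positivity
  have hD : ∀ a b, |Dst φ N w x a b| ≤ κ + F / κ := fun a b => by
    refine abs_le_eps hκ ((le_add_of_nonneg_right (sq_nonneg _)).trans' ?_)
    exact (Finset.single_le_sum (f := fun k => Dst φ N w x a k ^ 2) (fun _ _ => sq_nonneg _)
      (Finset.mem_univ b)).trans (Finset.single_le_sum (f := fun j => ∑ k, Dst φ N w x j k ^ 2)
        (fun _ _ => Finset.sum_nonneg fun _ _ => sq_nonneg _) (Finset.mem_univ a))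
  have hS : |∑ a, ∑ b, Dst φ N w x a b * A s x a b| ≤ 9 * ((κ + F / κ) * CA) := by
    calc |∑ a, ∑ b, Dst φ N w x a b * A s x a b| ≤ ∑ a, ∑ b, |Dst φ N w x a b * A s x a b| :=
          (Finset.abs_sum_le_sum_abs _ _).trans (Finset.sum_le_sum fun a _ =>
            Finset.abs_sum_le_sum_abs _ _)
      _ ≤ ∑ _a : Fin 3, ∑ _b : Fin 3, (κ + F / κ) * CA := by
          refine Finset.sum_le_sum fun a _ => Finset.sum_le_sum fun b _ => ?_
          rw [abs_mul]
          exact mul_le_mul (hD a b) (hA a b) (abs_nonneg _) (by positivity)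
      _ = 9 * ((κ + F / κ) * CA) := by simp [Finset.sum_const]; ring
  rw [RhsEnvelope.pcoll_eq_pkin_mul]
  unfold kinWA
  set P := pkin φ N w x
  set S := ∑ a, ∑ b, Dst φ N w x a b * A s x a b
  set Zm := hsCompressibility (rhoB φ N w x * σ ^ 3) - 1
  have hη₁0 : 0 ≤ η₁ := hη0.trans hhi
  by_cases hP : P = 0
  · rw [hP, div_zero, zero_mul, abs_zero]
    positivity
  · have h : 2 / 5 * S / P * (P * Zm) = 2 / 5 * S * Zm := by field_simp
    rw [h, abs_mul, abs_mul, abs_of_pos (by norm_num : (0 : ℝ) < 2 / 5)]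
    calc 2 / 5 * |S| * |Zm| ≤ 2 / 5 * (9 * ((κ + F / κ) * CA)) * (K * η₁) :=
          mul_le_mul (mul_le_mul_of_nonneg_left hS (by norm_num)) hZm (abs_nonneg _) (by positivity)
      _ = 18 / 5 * K * η₁ * CA * κ + 18 / 5 * K * η₁ * CA / κ * F := by ring

/-- **The reduction along an orbit, in `ℝ≥0∞`.** For `σ > 0`, `K ≥ 0`, `0 ≤ η₁ ≤ η_Z` with
`|Z(η) − 1| ≤ Kη` on `[0, η_Z]`, a nonnegative kernel, `|A_ab| ≤ C_A` on `[0, t] × 𝕋³`, an orbit with no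
block denser than `η₁/σ³` on `[0, t]`, `κ > 0`, `L = (18/5) K η₁ C_A` and `τ ∈ [0, t]`:
`ofReal |KfunA(τ)| ≤ ofReal (Lκt) + ofReal (L/κ) ∫⁻_{[0,t]}∫⁻ₓ ofReal (Σ D̄² + |q|²)(Φ_s z, x)`
(`‖∫ f‖ₑ ≤ ∫⁻ ‖f‖ₑ` twice — no integrability needed —, `abs_kin_le`, `vol 𝕋³ = 1`, `vol [0, τ] ≤ t`). [folklore] -/
theorem ofReal_abs_KfunA_le {σ K ηZ η₁ CA κ L t τ : ℝ} (hσ : 0 < σ) (hK : 0 ≤ K) (hη₁Z : η₁ ≤ ηZ)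
    (hZ : ∀ η : ℝ, 0 ≤ η → η ≤ ηZ → |hsCompressibility η - 1| ≤ K * η) (Φ : Flows σ)
    (hφ0 : ∀ y, 0 ≤ φ N y) {z : Cfg N} {A : ℝ → T3 → Fin 3 → Fin 3 → ℝ}
    (hAb : ∀ s ∈ Icc 0 t, ∀ (x : T3) (a b : Fin 3), |A s x a b| ≤ CA)
    (hdil : ∀ s ∈ Icc 0 t, ∀ x : T3, rhoB φ N ((Φ N).flow s z) x * σ ^ 3 ≤ η₁) (hκ : 0 < κ)
    (hCA : 0 ≤ CA) (hη₁ : 0 ≤ η₁) (hL : L = 18 / 5 * K * η₁ * CA) (hτ : τ ∈ Icc 0 t) :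
    ENNReal.ofReal |KfunA σ Φ φ A N z τ| ≤
      ENNReal.ofReal (L * κ * t) + ENNReal.ofReal (L / κ) *
        ∫⁻ s in Icc 0 t, ∫⁻ x, ENNReal.ofReal
          ((∑ j, ∑ k, Dst φ N ((Φ N).flow s z) x j k ^ 2) + ‖qfl φ N ((Φ N).flow s z) x‖ ^ 2) := by
  have hL0 : 0 ≤ L := by rw [hL]; positivity
  set g : ℝ → T3 → ℝ := fun s x => kinWA A φ N s ((Φ N).flow s z) x *
    pcoll σ (rhoB φ N ((Φ N).flow s z) x) (thetaB φ N ((Φ N).flow s z) x) with hg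
  set Fk : ℝ → T3 → ℝ≥0∞ := fun s x => ENNReal.ofReal
    ((∑ j, ∑ k, Dst φ N ((Φ N).flow s z) x j k ^ 2) + ‖qfl φ N ((Φ N).flow s z) x‖ ^ 2) with hFk
  change ENNReal.ofReal |∫ s in Icc 0 τ, ∫ x, g s x| ≤
    ENNReal.ofReal (L * κ * t) + ENNReal.ofReal (L / κ) * ∫⁻ s in Icc 0 t, ∫⁻ x, Fk s x
  -- the pointwise and slice bounds on `[0, t]`
  have hpt : ∀ s ∈ Icc 0 t, ∀ x, ‖g s x‖ₑ ≤ ENNReal.ofReal (L * κ) + ENNReal.ofReal (L / κ) * Fk s x := by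
    intro s hs x
    have h := abs_kin_le hσ hK hη₁Z hZ hφ0 (hAb s hs x) (hdil s hs x) hκ
    rw [← hL] at h
    rw [Real.enorm_eq_ofReal_abs]
    exact (ENNReal.ofReal_le_ofReal h).trans (ENNReal.ofReal_add_le.trans_eq (by
      rw [ENNReal.ofReal_mul (p := L / κ) (by positivity)]))
  have hslice : ∀ s ∈ Icc 0 t,
      ‖∫ x, g s x‖ₑ ≤ ENNReal.ofReal (L * κ) + ENNReal.ofReal (L / κ) * ∫⁻ x, Fk s x := fun s hs =>
    calc ‖∫ x, g s x‖ₑ ≤ ∫⁻ x, ‖g s x‖ₑ := enorm_integral_le_lintegral_enorm _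
      _ ≤ ∫⁻ x, (ENNReal.ofReal (L * κ) + ENNReal.ofReal (L / κ) * Fk s x) := lintegral_mono (hpt s hs)
      _ = _ := by rw [lintegral_add_left measurable_const, lintegral_const, measure_univ, mul_one,
          lintegral_const_mul' _ _ ENNReal.ofReal_ne_top]
  -- time integration on `[0, τ] ⊆ [0, t]`
  rw [← Real.enorm_eq_ofReal_abs]
  calc ‖∫ s in Icc 0 τ, ∫ x, g s x‖ₑ ≤ ∫⁻ s in Icc 0 τ, ‖∫ x, g s x‖ₑ := enorm_integral_le_lintegral_enorm _
    _ ≤ ∫⁻ s in Icc 0 τ, (ENNReal.ofReal (L * κ) + ENNReal.ofReal (L / κ) * ∫⁻ x, Fk s x) :=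
        setLIntegral_mono' measurableSet_Icc fun s hs => hslice s ⟨hs.1, hs.2.trans hτ.2⟩
    _ = ENNReal.ofReal (L * κ) * volume (Icc (0 : ℝ) τ) +
          ENNReal.ofReal (L / κ) * ∫⁻ s in Icc 0 τ, ∫⁻ x, Fk s x := by
        rw [lintegral_add_left measurable_const, setLIntegral_const, lintegral_const_mul' _ _ ENNReal.ofReal_ne_top]
    _ ≤ _ := by
        refine add_le_add ?_ (mul_le_mul_right (lintegral_mono_set (Icc_subset_Icc_right hτ.2)) _)
        rw [Real.volume_Icc, sub_zero, ← ENNReal.ofReal_mul (by positivity)]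
        exact ENNReal.ofReal_le_ofReal (mul_le_mul_of_nonneg_left hτ.2 (by positivity))

/-! ### Statics: the mean of the kinetic integrand vanishes for a bounded kernel family -/

/-- If `G ≤ 2A + 4B + T/2 + 50B₂` with `A, T ≥ 0` then `ofReal G ≤ 4 ofReal (A + B) + 50 ofReal (T + B₂)` in
`ℝ≥0∞`. [folklore] -/
-- adapted from …Theorems/CollisionIsometryCLTCollisionalTransferLocalityFmrConst.lean (private there)
theorem ofReal_le_of_dominators {G A B T B₂ : ℝ} (h : G ≤ 2 * A + 4 * B + 1 / 2 * T + 50 * B₂)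
    (hA : 0 ≤ A) (hT : 0 ≤ T) :
    ENNReal.ofReal G ≤ 4 * ENNReal.ofReal (A + B) + 50 * ENNReal.ofReal (T + B₂) := by
  have hle : G ≤ 4 * (A + B) + 50 * (T + B₂) := by linarith
  calc ENNReal.ofReal G ≤ ENNReal.ofReal (4 * (A + B) + 50 * (T + B₂)) := ENNReal.ofReal_le_ofReal hle
    _ ≤ ENNReal.ofReal (4 * (A + B)) + ENNReal.ofReal (50 * (T + B₂)) := ENNReal.ofReal_add_le
    _ = 4 * ENNReal.ofReal (A + B) + 50 * ENNReal.ofReal (T + B₂) := by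
        rw [ENNReal.ofReal_mul (by norm_num), ENNReal.ofReal_mul (by norm_num),
          ENNReal.ofReal_ofNat, ENNReal.ofReal_ofNat]

/-- `(w, x) ↦ T + B₂ = Σ_a ⟨φ |v|² v_a⟩² + |m̄|² (Ē/ρ̄)²` (`BlockHeatFluxDominatorConst.F`) is measurable
for a continuous kernel. [folklore] -/
-- adapted from …Theorems/CollisionIsometryCLTCollisionalTransferLocalityBlockHeatFluxDominatorConst.lean
theorem measurable_heatDom (hφc : Continuous (φ N)) :
    Measurable (uncurry fun (z : Cfg N) (x : T3) => ENNReal.ofReal (BlockHeatFluxDominatorConst.F φ N z x)) := by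
  haveI : ∀ _i : Fin (N + 1), BorelSpace (T3 × V3) := fun _ => Prod.borelSpace
  have hT : Measurable fun p : Cfg N × T3 => BlockHeatFluxDominatorConst.Tm φ N p.1 p.2 := by
    unfold BlockHeatFluxDominatorConst.Tm
    fun_prop
  have hB : Measurable fun p : Cfg N × T3 =>
      ‖mB φ N p.1 p.2‖ ^ 2 * (EB φ N p.1 p.2 / rhoB φ N p.1 p.2) ^ 2 :=
    ((continuous_mB hφc).measurable.norm.pow_const 2).mul
      (((continuous_EB hφc).measurable.div (continuous_rhoB hφc).measurable).pow_const 2)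
  exact (hT.add hB).ennreal_ofReal

/-- **Statics of the kinetic integrand for a bounded kernel family.** Under the homogeneous local
Gibbs law (`σ ≤ 1/2`, `θ > 0`, any flow family) and for continuous kernels `0 ≤ φ_N ≤ M` of mass one
with `M` FIXED, `E_{G_N} ∫⁻ₓ ofReal (Σ_jk D̄_jk² + |q|²) → 0`: pointwise
`Σ D̄² + |q|² ≤ 4(A + B) + 50(T + B₂)` ([KF-dom] `stub_kineticIntegrand_le_dominators`), and the means
of the two dominators are `≤ M K_θ/√(N+1)` (`BlockStressDominatorConst.lintegral_dominator_le`) and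
`≤ (5/4) E|v|⁶ M/(N+1)` (`BlockHeatFluxDominatorConst.lintegral_F_le`). [folklore] -/
theorem tendsto_lintegral_kinetic {σ θ : ℝ} (hθ : 0 < θ) (hσ : σ ≤ 1 / 2) (Φ : Flows σ)
    (hφc : ∀ N, Continuous (φ N)) (hφ0 : ∀ N y, 0 ≤ φ N y) {M : ℝ} (hφM : ∀ N y, φ N y ≤ M)
    (hφ1 : ∀ N, ∫ y, φ N y = 1) :
    Tendsto (fun N : ℕ => ∫⁻ z, (∫⁻ x, ENNReal.ofReal
        ((∑ j, ∑ k, Dst φ N z x j k ^ 2) + ‖qfl φ N z x‖ ^ 2))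
      ∂(localGibbsLaw σ (fun _ => 1) (fun _ => 0) (fun _ => θ) N (Φ N))) atTop (𝓝 0) := by
  -- the two dominators with their mean bounds (the Gaussian constants are read off by unification)
  obtain ⟨Kθ, m6, hdom⟩ : ∃ Kθ m6 : ℝ, ∀ N : ℕ, ∃ D₁ : Cfg N → T3 → ℝ,
      (∀ (w : Cfg N) (x : T3), ENNReal.ofReal ((∑ j, ∑ k, Dst φ N w x j k ^ 2) + ‖qfl φ N w x‖ ^ 2) ≤
        4 * ENNReal.ofReal (D₁ w x) + 50 * ENNReal.ofReal (BlockHeatFluxDominatorConst.F φ N w x)) ∧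
      ∫⁻ z, (∫⁻ x, ENNReal.ofReal (D₁ z x)) ∂(localGibbsLaw σ (fun _ => 1) (fun _ => 0) (fun _ => θ) N (Φ N)) ≤
        ENNReal.ofReal (M / Real.sqrt ((N : ℝ) + 1) * Kθ) ∧
      ∫⁻ z, (∫⁻ x, ENNReal.ofReal (BlockHeatFluxDominatorConst.F φ N z x))
          ∂(localGibbsLaw σ (fun _ => 1) (fun _ => 0) (fun _ => θ) N (Φ N)) ≤ ENNReal.ofReal (((N : ℝ) + 1)⁻¹ * M * m6) :=
    ⟨_, _, fun N => ⟨_, fun w x => ofReal_le_of_dominators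
      (stub_kineticIntegrand_le_dominators θ φ N w x (hφ0 N))
      (Finset.sum_nonneg fun _ _ => Finset.sum_nonneg fun _ _ => sq_nonneg _)
      (Finset.sum_nonneg fun _ _ => sq_nonneg _),
      BlockStressDominatorConst.lintegral_dominator_le hθ hσ Φ N (hφc N) (hφ0 N) (hφM N) (hφ1 N),
      BlockHeatFluxDominatorConst.lintegral_F_le hθ hσ Φ N (hφc N) (hφ0 N) (hφM N) (hφ1 N)⟩⟩
  have h1 : Tendsto (fun N : ℕ => ENNReal.ofReal (M / Real.sqrt ((N : ℝ) + 1) * Kθ)) atTop (𝓝 0) := by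
    refine (BlockStressDominatorConst.tendsto_ofReal_mul_rpow_div_sqrt (γ := 0) (by norm_num)
      (M * Kθ)).congr fun N => ?_
    rw [mul_zero, Real.rpow_zero]; congr 1; ring
  have h2 : Tendsto (fun N : ℕ => ENNReal.ofReal (((N : ℝ) + 1)⁻¹ * M * m6)) atTop (𝓝 0) := by
    refine (BlockVelocityLLNConst.tendsto_ofReal_mul_rpow (γ := 0) (by norm_num) (M * m6)).congr
      fun N => ?_
    rw [mul_zero, zero_sub, Real.rpow_neg_one]; congr 1; ring
  have hrate : Tendsto (fun N : ℕ => 4 * ENNReal.ofReal (M / Real.sqrt ((N : ℝ) + 1) * Kθ) +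
      50 * ENNReal.ofReal (((N : ℝ) + 1)⁻¹ * M * m6)) atTop (𝓝 0) := by
    have h := (ENNReal.Tendsto.const_mul (a := 4) h1 (Or.inr ENNReal.ofNat_ne_top)).add
      (ENNReal.Tendsto.const_mul (a := 50) h2 (Or.inr ENNReal.ofNat_ne_top))
    simpa only [mul_zero, add_zero] using h
  refine tendsto_of_tendsto_of_tendsto_of_le_of_le tendsto_const_nhds hrate (fun _ => zero_le) fun N => ?_
  -- the per-`N` bound: integrate the pointwise domination in `x`, then in `z`
  obtain ⟨D₁, hpt, hI1, hI2⟩ := hdom N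
  have hFm := measurable_heatDom (N := N) (hφc N)
  have hx : ∀ w : Cfg N, ∫⁻ x, ENNReal.ofReal ((∑ j, ∑ k, Dst φ N w x j k ^ 2) + ‖qfl φ N w x‖ ^ 2) ≤
      4 * (∫⁻ x, ENNReal.ofReal (D₁ w x)) +
        50 * ∫⁻ x, ENNReal.ofReal (BlockHeatFluxDominatorConst.F φ N w x) := by
    intro w
    have h2 : Measurable fun x : T3 => ENNReal.ofReal (BlockHeatFluxDominatorConst.F φ N w x) := hFm.of_uncurry_left
    refine (lintegral_mono (hpt w)).trans_eq ?_
    rw [lintegral_add_right _ (h2.const_mul _), lintegral_const_mul' _ _ ENNReal.ofNat_ne_top,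
      lintegral_const_mul _ h2]
  refine (lintegral_mono hx).trans ?_
  rw [lintegral_add_right _ (hFm.lintegral_prod_right.const_mul _),
    lintegral_const_mul' _ _ ENNReal.ofNat_ne_top, lintegral_const_mul _ hFm.lintegral_prod_right]
  exact add_le_add (mul_le_mul_right hI1 _) (mul_le_mul_right hI2 _)

/-! ### Markov, Tonelli and stationarity -/

/-- **Union bound + Markov + Tonelli + stationarity.** For a flow family `Φ`, an s-finite measure `P`
on phase space carried by the good set of `Φ N` and invariant under every flow map `Φ_s` in the
`lintegral` sense, a measurable `G : Cfg N → ℝ≥0∞`, constants `c ∈ (0, ∞)`, `a`, and events `E`, `C`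
such that at every good point of `E ∖ C`, `c ≤ a ∫⁻_{[0,t]} G(Φ_s z) ds`: `P E ≤ P C + a (t ∫⁻ G dP) / c`
(off the null bad set, through the jointly measurable modification of the flow `exists_measurable_flow`). [folklore] -/
-- adapted from …Theorems/CollisionIsometryCLTCollisionalTransferLocalityFmrConst.lean (private `measure_lt_setIntegral_le`)
theorem measure_le_of_stationary {σ : ℝ} (Φ : Flows σ) (N : ℕ) (P : Measure (Cfg N)) [SFinite P]
    (hPg : P (Φ N).goodᶜ = 0)
    (hst : ∀ (s : ℝ) (g : Cfg N → ℝ≥0∞), Measurable g → ∫⁻ z, g ((Φ N).flow s z) ∂P = ∫⁻ z, g z ∂P)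
    (G : Cfg N → ℝ≥0∞) (hG : Measurable G) (t : ℝ) {c a : ℝ≥0∞} (hc : c ≠ 0) (hc' : c ≠ ⊤)
    {E C : Set (Cfg N)}
    (hE : ∀ z ∈ (Φ N).good, z ∈ E → z ∉ C → c ≤ a * ∫⁻ s in Icc 0 t, G ((Φ N).flow s z)) :
    P E ≤ P C + a * (ENNReal.ofReal t * ∫⁻ z, G z ∂P) / c := by
  obtain ⟨Fm, hFm, hF⟩ := exists_measurable_flow Φ N
  have hgood : ∀ᵐ z ∂P, z ∈ (Φ N).good := ae_iff.2 hPg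
  have hGF : Measurable fun q : ℝ × Cfg N => G (Fm q) := hG.comp hFm
  have hYm : Measurable fun z : Cfg N => ∫⁻ s in Icc 0 t, G (Fm (s, z)) := hGF.lintegral_prod_left'
  -- union bound off the null bad set: `E ⊆ goodᶜ ∪ (C ∪ {c ≤ a Y})`
  have hsub : E ⊆ (Φ N).goodᶜ ∪ (C ∪ {z | c ≤ a * ∫⁻ s in Icc 0 t, G (Fm (s, z))}) := by
    intro z hzE
    by_cases hz : z ∈ (Φ N).good
    · refine Or.inr ((em (z ∈ C)).imp id fun hzC => ?_)
      rw [mem_setOf_eq]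
      have hF' : ∀ s, Fm (s, z) = (Φ N).flow s z := fun s => hF s z hz
      simp only [hF']
      exact hE z hz hzE hzC
    · exact Or.inl hz
  have h1 : P E ≤ P C + P {z | c ≤ a * ∫⁻ s in Icc 0 t, G (Fm (s, z))} := by
    refine (measure_mono hsub).trans (((measure_union_le _ _).trans
      (add_le_add le_rfl (measure_union_le _ _))).trans_eq ?_)
    rw [hPg, zero_add]
  have h2 : P {z | c ≤ a * ∫⁻ s in Icc 0 t, G (Fm (s, z))} ≤
      (∫⁻ z, a * (∫⁻ s in Icc 0 t, G (Fm (s, z))) ∂P) / c :=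
    meas_ge_le_lintegral_div (hYm.const_mul a).aemeasurable hc hc'
  have h3 : ∫⁻ z, a * (∫⁻ s in Icc 0 t, G (Fm (s, z))) ∂P = a * (ENNReal.ofReal t * ∫⁻ z, G z ∂P) := by
    rw [lintegral_const_mul a hYm]
    congr 1
    have hsw : AEMeasurable (uncurry fun (z : Cfg N) (s : ℝ) => G (Fm (s, z)))
        (P.prod (volume.restrict (Icc 0 t))) := (hGF.comp measurable_swap).aemeasurable
    have hs : ∀ s : ℝ, ∫⁻ z, G (Fm (s, z)) ∂P = ∫⁻ z, G z ∂P := fun s =>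
      calc ∫⁻ z, G (Fm (s, z)) ∂P = ∫⁻ z, G ((Φ N).flow s z) ∂P :=
            lintegral_congr_ae (hgood.mono fun z hz =>
              show G (Fm (s, z)) = G ((Φ N).flow s z) by rw [hF s z hz])
        _ = ∫⁻ z, G z ∂P := hst s G hG
    rw [lintegral_lintegral_swap hsw, lintegral_congr hs, setLIntegral_const, Real.volume_Icc,
      sub_zero, mul_comm]
  exact h1.trans (add_le_add le_rfl (h2.trans_eq (by rw [h3])))

end KfunAConeConst

/-! ## The registered stub -/

open KfunAConeConst in
/-- **[K0C] Registered stub `stub_kfunA_cone_const` (line `hemisphere-affine-slaving`, crux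
`CollisionalTransferLocality`, stmt-AtomisticToContinuum-9518): THE KINETIC-CORRECTION FUNCTIONAL OF THE
CONE KERNEL VANISHES AT GLOBAL EQUILIBRIUM.** For every `θ > 0` there is `σ₀ > 0`
(`min σ_MC (min 1/2 (η_Z/2))`) such that for `0 < σ < σ₀`, every flow family `Φ`, `t > 0`, `0 < r < 1/4`,
every matrix weight `A` smooth on `[0, t]`, `τ ∈ [0, t]` and `δ > 0`:
`G_N {z | δ < |KfunA σ Φ (b_r(·, 0)) A N z τ|} → 0` under `G_N = localGibbsLaw σ 1 0 θ N (Φ N)`.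
Off the mollified-ceiling event ([MC], probability `→ 0`) every block has `ρ_r σ³ ≤ 2σ³ ≤ η_Z`, so
`ofReal |KfunA(τ)| ≤ ofReal (δ/2) + ofReal (L/κ) ∫⁻_{[0,t]}∫⁻ₓ ofReal (Σ D̄² + |q|²)` ([Z], `abs_kin_le`,
`ofReal_abs_KfunA_le`, `Lκt ≤ δ/2`); union bound, Markov, Tonelli and stationarity
(`measure_le_of_stationary`) and the Gaussian statics of the dominators at the fixed kernel bound
`3/(π r³)` (`tendsto_lintegral_kinetic`) give `≤ P(ceiling) + (L/κ) t E_N G/(δ/2) → 0`. [folklore] -/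
theorem stub_kfunA_cone_const : ∀ θ : ℝ, 0 < θ → ∃ σ₀ : ℝ, 0 < σ₀ ∧ ∀ σ : ℝ, 0 < σ → σ < σ₀ → ∀ (Φ : Flows σ) (t : ℝ), 0 < t → ∀ (r : ℝ), 0 < r → r < 1 / 4 → ∀ (A : ℝ → T3 → Fin 3 → Fin 3 → ℝ), SmoothMatrixOn (Icc 0 t) A → ∀ τ ∈ Icc 0 t, ∀ δ : ℝ, 0 < δ → Tendsto (fun N : ℕ => Literature.MathematicalPhysics.KineticTheory.localGibbsLaw σ (fun _ => 1) (fun _ => 0) (fun _ => θ) N (Φ N) {z | δ < |KfunA σ Φ (fun (_ : ℕ) (y : T3) => Literature.MathematicalPhysics.KineticTheory.coneKernel r y 0) A N z τ|}) atTop (𝓝 0) := by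
  intro θ hθ
  obtain ⟨σc, hσc, hceil⟩ := stub_mollifiedCeilingConst θ hθ
  obtain ⟨ηZ, hηZ, K, hK, hZ⟩ := stub_hsCompressibility_linear
  refine ⟨min σc (min (1 / 2) (ηZ / 2)), lt_min hσc (lt_min (by norm_num) (by positivity)), ?_⟩
  intro σ hσ hσlt Φ t ht r hr hr4 A hA τ hτ δ hδ
  have hσc' : σ < σc := hσlt.trans_le (min_le_left _ _)
  have hσ2 : σ ≤ 1 / 2 := (hσlt.trans_le ((min_le_right _ _).trans (min_le_left _ _))).le
  have hσZ : σ ≤ ηZ / 2 := (hσlt.trans_le ((min_le_right _ _).trans (min_le_right _ _))).le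
  set η₁ : ℝ := 2 * σ ^ 3 with hη₁
  have hη₁Z : η₁ ≤ ηZ := by linarith [pow_le_of_le_one hσ.le (by linarith) three_ne_zero]
  -- the cone kernel family: continuous, `0 ≤ · ≤ 3/(π r³)`, mass one
  set φc : ℕ → T3 → ℝ := fun _ y => coneKernel r y 0 with hφc_def
  have hck : Continuous fun y : T3 => coneKernel r y 0 := by
    have hd : Continuous fun y : T3 => Literature.Analysis.FluidPDE.Torus.euclidDist y (0 : T3) := by
      simpa only [Function.comp_def, id_eq] using
        Literature.Analysis.FluidPDE.Torus.continuous_euclidDist.comp (continuous_id.prodMk continuous_const)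
    unfold Literature.MathematicalPhysics.KineticTheory.coneKernel
    exact continuous_const.mul ((continuous_const.sub (hd.div_const r)).max continuous_const)
  have hφc : ∀ N, Continuous (φc N) := fun _ => hck
  have hφ0 : ∀ N y, 0 ≤ φc N y := fun _ y => (coneKernel_mem_Icc hr y 0).1
  have hφM : ∀ N y, φc N y ≤ 3 / (Real.pi * r ^ 3) := fun _ y => (coneKernel_mem_Icc hr y 0).2
  have hφ1 : ∀ N, ∫ y, φc N y = 1 := fun _ => integral_coneKernel hr (by linarith) 0
  -- the weight bound and the constants `L`, `κ` with `L κ t ≤ δ/2`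
  obtain ⟨CA, hCA, hAb⟩ := KfunAConst.exists_bound_of_smoothMatrixOn hA
  set L : ℝ := 18 / 5 * K * η₁ * CA with hL
  have hL0 : 0 ≤ L := by positivity
  set κ : ℝ := δ / (2 * L * t + 1) with hκ
  have hκ0 : 0 < κ := by positivity
  have hLκ : L * κ * t ≤ δ / 2 := by
    rw [hκ, show L * (δ / (2 * L * t + 1)) * t = L * t * δ / (2 * L * t + 1) by ring,
      div_le_iff₀ (by positivity)]
    nlinarith [mul_nonneg hL0 ht.le]
  have hc : ENNReal.ofReal (δ / 2) ≠ 0 := (ENNReal.ofReal_pos.2 (half_pos hδ)).ne'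
  -- the laws, the ceiling events, the block functional `G_N`
  set P : (N : ℕ) → Measure (Cfg N) :=
    fun N => localGibbsLaw σ (fun _ => 1) (fun _ => 0) (fun _ => θ) N (Φ N) with hP
  haveI hPr : ∀ N, IsProbabilityMeasure (P N) := fun N =>
    isProbabilityMeasure_localGibbsLaw (a₀ := fun _ => 1) (θ₀ := fun _ => θ) (u₀ := fun _ => 0)
      continuous_const continuous_const continuous_const (fun _ => one_pos) (fun _ => hθ) hσ2 N (Φ N)
  set Ceil : (N : ℕ) → Set (Cfg N) :=
    fun N => {z | ∃ s ∈ Icc 0 t, ∃ x : T3, 2 < mollDensity r ((Φ N).flow s z) x} with hCeil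
  set G : (N : ℕ) → Cfg N → ℝ≥0∞ := fun N w => ∫⁻ x, ENNReal.ofReal
    ((∑ j, ∑ k, Dst φc N w x j k ^ 2) + ‖qfl φc N w x‖ ^ 2) with hG
  have hGm : ∀ N, Measurable (G N) := fun N =>
    (measurable_kineticIntegrand φc N (hφc N)).ennreal_ofReal.lintegral_prod_right'
  have hbound : ∀ N : ℕ, P N {z | δ < |KfunA σ Φ φc A N z τ|} ≤
      P N (Ceil N) + ENNReal.ofReal (L / κ) * (ENNReal.ofReal t * ∫⁻ z, G N z ∂(P N)) /
        ENNReal.ofReal (δ / 2) := by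
    intro N
    refine measure_le_of_stationary Φ N (P N) (localGibbsLaw_compl_good' (Φ N))
      (fun s g hg => lintegral_comp_flow_localGibbsLaw_const σ 1 θ 0 N (Φ N) s hg) (G N) (hGm N) t
      hc ENNReal.ofReal_ne_top fun z hz hzδ hzC => ?_
    -- off the ceiling event the orbit is dilute at level `η₁ = 2σ³`
    have hdil : ∀ s ∈ Icc 0 t, ∀ x : T3, rhoB φc N ((Φ N).flow s z) x * σ ^ 3 ≤ η₁ := by
      intro s hs x
      have h2 : mollDensity r ((Φ N).flow s z) x ≤ 2 := not_lt.1 fun h => hzC ⟨s, hs, x, h⟩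
      have hρ : rhoB φc N ((Φ N).flow s z) x = mollDensity r ((Φ N).flow s z) x :=
        ConeValue.rhoB_cone r N _ x
      rw [hρ]
      exact mul_le_mul_of_nonneg_right h2 (pow_nonneg hσ.le 3)
    have hcore := ofReal_abs_KfunA_le hσ hK hη₁Z hZ Φ (hφ0 N) hAb hdil hκ0 hCA (by positivity) hL hτ
    have h1 : ENNReal.ofReal (δ / 2) + ENNReal.ofReal (δ / 2) ≤
        ENNReal.ofReal (δ / 2) + ENNReal.ofReal (L / κ) * ∫⁻ s in Icc 0 t, G N ((Φ N).flow s z) :=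
      calc ENNReal.ofReal (δ / 2) + ENNReal.ofReal (δ / 2) = ENNReal.ofReal δ := by
            rw [← ENNReal.ofReal_add (by positivity) (by positivity), add_halves]
        _ ≤ ENNReal.ofReal |KfunA σ Φ φc A N z τ| := ENNReal.ofReal_le_ofReal (le_of_lt hzδ)
        _ ≤ _ := hcore
        _ ≤ _ := add_le_add_left (ENNReal.ofReal_le_ofReal hLκ) _
    exact (ENNReal.add_le_add_iff_left ENNReal.ofReal_ne_top).1 h1
  have hlim : Tendsto (fun N : ℕ => P N (Ceil N) +
      ENNReal.ofReal (L / κ) * (ENNReal.ofReal t * ∫⁻ z, G N z ∂(P N)) / ENNReal.ofReal (δ / 2))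
      atTop (𝓝 0) := by
    have h1 : Tendsto (fun N : ℕ => P N (Ceil N)) atTop (𝓝 0) := hceil σ hσ hσc' Φ t r ht hr hr4
    have h2 : Tendsto (fun N : ℕ => ∫⁻ z, G N z ∂(P N)) atTop (𝓝 0) :=
      tendsto_lintegral_kinetic hθ hσ2 Φ hφc hφ0 hφM hφ1
    have h3 := ENNReal.Tendsto.div_const (b := ENNReal.ofReal (δ / 2)) (ENNReal.Tendsto.const_mul
      (a := ENNReal.ofReal (L / κ)) (ENNReal.Tendsto.const_mul (a := ENNReal.ofReal t) h2
        (Or.inr ENNReal.ofReal_ne_top)) (Or.inr ENNReal.ofReal_ne_top)) (Or.inr hc)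
    simp only [mul_zero, ENNReal.zero_div] at h3
    simpa only [add_zero] using h1.add h3
  exact tendsto_of_tendsto_of_tendsto_of_le_of_le tendsto_const_nhds hlim (fun _ => zero_le) hbound

end

end Summit.AtomisticToContinuum.HydrodynamicLimit.Theorems.HemisphereAffineSlaving
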